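import Literature.NumberTheory.GaloisRepresentations.IdeleClassBarS
import Literature.NumberTheory.GaloisRepresentations.IdeleClassModUnitsSInflation
import Literature.NumberTheory.GaloisRepresentations.RestrictedRamificationOpenSubgroupLayers
import Literature.NumberTheory.GaloisRepresentations.GalLayerSystemSubgroupLayers
import Literature.Algebra.Homology.RepCokernelCarrier
import Literature.Algebra.Homology.DiscreteRepLayerColimitGroupCohomology
import Literature.Algebra.Homology.DiscreteRepOpenSubgroup
import HarnessLib

/-!
# The finite layers of `C̄_S` over an open `U = H/N_S ≤ G_S`: `(Res_U C̄_S)^{Gal(K_S/E)}` IS `C_S(E) = C_E ⧸ U_{E,S}` as a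
# module over `U ⧸ Gal(K_S/E) ≅ H_E ≤ Gal(E/K)` (Harari Thm. 17.2: `C_S = lim→_{E ⊆ K_S} C_S(E)`; Serre I §2.2 Prop. 8)

Topic `NumberTheory/GaloisRepresentations`; namespace `Literature.NumberTheory.GaloisRepresentations.IdeleClassBar.SLayers`.
Definitions with bodies (the restricted object, the layer group isomorphism, the layer module map — plumbing) and theorems;
no named fact, no instance, no `sorry`.  Sequel of -w3 g17's `IdeleClassBarS` / `IdeleClassBarSLayerKernel` (D1-(ii): `C̄_S =
classBarSRep K S`, `ofLayerS hE : C_E → C̄_S`, its kernel `U_{E,S}`), of `IdeleClassModUnitsSInflation` (-w4 g19, T2c: the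
transitions `classModUnitsInflHom` of `C_S(·)`), of the TATE lane's `RestrictedRamificationOpenSubgroupLayers`
(`galoisGroupAbove`, `toAbove`, `layerSubgroup`) and door-c6's `GalLayerSystemSubgroupLayers` (`subgroupImage`,
`toSubgroupImage`, `subgroupImageRes`), with the generic `RepCokernelCarrier` (maps out of the carrier of a `Rep`-cokernel)
and door-c4's layer system (`DiscreteRep.resD`, `invariantsQuotFunctor`, `stepG`).

THE POINT (Serre I §2.2 Prop. 8 for the `S`-idèle class module).  For `H ≤ Γ_K` open with `N_S ≤ H`, `U := H/N_S ≤ G_S`,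
and a finite Galois layer `E ⊆ K_S` over `K` with `K̄^H ≤ E` (layer subgroup `V̄_E = Gal(K_S/E) ≤ U`), the layer of door-c4's
direct system computing `Hʳ(U, C̄_S)`, i.e. `(Res_U C̄_S)^{V̄_E}` as a module over `U ⧸ V̄_E`, is identified with the
`S`-idèle class layer `C_S(E) = IdeleCohomology.classModUnitsRep K E.1 S` restricted to the image `H_E ≤ Gal(E/K)` of `H`:
* §1 `resSD K S H := (resD ℤ U).obj (classBarSD K S)` and the layer objects `layerRepS` (door-c4's `invariantsQuotFunctor`);
* §2 **`layerGroupEquiv : ↥U ⧸ V̄_E ≃* ↥(subgroupImage H E)`** (`[σ N_S] ↦ σ|_E`; values `coe_layerGroupEquiv_mk_toAbove`);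
* §3 **`toLayerS : C_S(E) →ₗ[ℤ] (Res_U C̄_S)^{V̄_E}`**, the descent of `ofLayerS hE` through `C_E ↠ C_S(E)` (`RepCokernel.desc`;
  `toLayerS_π`), INJECTIVE by -w3 g17's kernel theorem `ofLayerS_eq_zero_iff` (`toLayerS_injective`), and SURJECTIVE exactly
  when `C̄_S^{Gal(K_S/E)} ⊆ im(C_E → C̄_S)` (`toLayerS_surjective_of_image`; the image theorem is -w3's sequel and is taken
  here as the section hypothesis `himg`), with the equivariance `toLayerS (σ|_E • y) = [σ N_S] • toLayerS y` (`toLayerS_ρ`);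
* §4 given the image hypothesis, the module isomorphism `layerModuleEquivS` and the COHOMOLOGY isomorphism
  **`layerCohomologyIsoS : Hⁿ(↥U ⧸ V̄_E, (Res_U C̄_S)^{V̄_E}) ≅ Hⁿ(H_E, Res_{H_E} C_S(E))`** (Mathlib `groupCohomology.mapIso`);
(The TRANSITIONS — for layers `E ≤ M`, door-c4's `stepG V̄_E V̄_M` corresponds under these isomorphisms to the relative
inflation `map (subgroupImageRes H h) (classModUnitsInflHom K E M S)|` of T2b/T2c — are the sequel
`IdeleClassBarSLayerTransitions`.)  The kernel and image statements for `C_E → C̄_S` are taken as the inline section hypotheses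
`hker` / `himg` (-w3 g17's `IdeleClassBarSLayerKernel.ofLayerS_eq_zero_iff` and its announced sequel
discharge them); no `sorry`.

Cell `bsd-eis`, background lane «PT-Ш-S-TC» of crux `GoodLatticeBDPValue` (stmt-BirchSwinnertonDyer-19032), brick D2-TN (W2/W3),
seat bsd-line-x1-p1-w4 g19.  HONEST FRAMING: bookkeeping between two presentations of the same finite layers; no duality
theorem and no case of BSD is proved here.

## References
* J.-P. Serre, *Cohomologie galoisienne* (1994), I §2.2 Prop. 8 (`H^q(G, A) = lim→ H^q(G/U, A^U)`). [SerreGaloisCohomology1997]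
* D. Harari, *Galois Cohomology and Class Field Theory* (2020), Def. 15.38, §17.1 Thm. 17.2, §17.4 (17.1). [Harari2020]
* J. Neukirch, A. Schmidt, K. Wingberg, *Cohomology of Number Fields*, 2nd ed. (2008), VIII §3 (8.3.7)–(8.3.9).
  [NeukirchSchmidtWingberg2008]
-/

noncomputable section

open NumberField IsDedekindDomain CategoryTheory CategoryTheory.Limits groupCohomology
open Field (absoluteGaloisGroup)
open Literature.NumberTheory.Automorphic Literature.NumberTheory.Automorphic.IdeleClassGroup
open Literature.Algebra.Homology Literature.Algebra.Homology.DiscreteRep Literature.Algebra.Homology.DiscreteRep.LayerColimit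
open Literature.NumberTheory.GaloisRepresentations.LocalWeilDatum (galFixing mem_galFixing_iff)
open Literature.NumberTheory.IwasawaTheory.Greenberg2006 (galoisGroupAbove)
open scoped Classical

namespace Literature.NumberTheory.GaloisRepresentations

namespace IdeleClassBar

namespace SLayers

variable (K : Type) [Field K] [NumberField K] (S : Finset (HeightOneSpectrum (𝓞 K)))
  (H : Subgroup (absoluteGaloisGroup K))

/-! ## §1. `Res_U C̄_S` and its layers -/

/-- **`Res_U C̄_S ∈ C_{↥U}`** for `U = galoisGroupAbove S H = H/N_S ≤ G_S` (door-c4's `resD` applied to -w3's `classBarSD`).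
[cite: Harari2020, §17.1 Thm. 17.2] [cite: SerreGaloisCohomology1997, I §2.2 Prop. 8] -/
abbrev resSD : DiscreteRepCat ℤ ↥(galoisGroupAbove (↑S : Set (HeightOneSpectrum (𝓞 K))) H) :=
  (resD ℤ (galoisGroupAbove (↑S : Set (HeightOneSpectrum (𝓞 K))) H)).obj (classBarSD K S)

variable {K S H}

/-- The action of `u ∈ U` on `Res_U C̄_S` is that of `u ∈ G_S` on `C̄_S` (unfolding). [cite: Harari2020, §17.1 Thm. 17.2] -/
theorem resSD_ρ_apply (u : ↥(galoisGroupAbove (↑S : Set (HeightOneSpectrum (𝓞 K))) H)) (z : (classBarSRep K S).V) :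
    (resSD K S H).obj.ρ u z = (classBarSRep K S).ρ (u : GaloisGroupUnramifiedOutside K ↑S) z := rfl

variable (hHo : IsOpen (H : Set (absoluteGaloisGroup K))) (E : GalLayer K) (hF : OpenSubgroupLayer.baseField H ≤ E.1)
  (hS : ramificationSubgroup K (↑S : Set (HeightOneSpectrum (𝓞 K))) ≤ galFixing K E.1)

/-- **The layer object `(Res_U C̄_S)^{V̄_E}`** at the layer subgroup `V̄_E = Gal(K_S/E) ≤ U` (door-c4's `invariantsQuotFunctor`,
a `Rep` of `↥U ⧸ V̄_E`; an abbreviation so that `stepG` / `inflG` apply verbatim). [cite: SerreGaloisCohomology1997, I §2.2 Prop. 8] -/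
abbrev layerRepS :
    Rep ℤ (↥(galoisGroupAbove (↑S : Set (HeightOneSpectrum (𝓞 K))) H) ⧸
      ((OpenSubgroupLayer.layerSubgroup (↑S : Set (HeightOneSpectrum (𝓞 K))) hHo E hF hS :
          OpenNormalSubgroup ↥(galoisGroupAbove (↑S : Set (HeightOneSpectrum (𝓞 K))) H)) :
        Subgroup ↥(galoisGroupAbove (↑S : Set (HeightOneSpectrum (𝓞 K))) H))) :=
  (invariantsQuotFunctor ℤ
    ((OpenSubgroupLayer.layerSubgroup (↑S : Set (HeightOneSpectrum (𝓞 K))) hHo E hF hS :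
        OpenNormalSubgroup ↥(galoisGroupAbove (↑S : Set (HeightOneSpectrum (𝓞 K))) H)) :
      Subgroup ↥(galoisGroupAbove (↑S : Set (HeightOneSpectrum (𝓞 K))) H))).obj (resSD K S H)

/-- The action of `[u] ∈ ↥U ⧸ V̄_E` on the layer object is that of `u ∈ G_S` on `C̄_S`, on underlying elements (unfolding).
[cite: SerreGaloisCohomology1997, I §2.2 Prop. 8] -/
theorem coe_layerRepS_ρ_mk (u : ↥(galoisGroupAbove (↑S : Set (HeightOneSpectrum (𝓞 K))) H))
    (z : (layerRepS hHo E hF hS).V) :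
    ((layerRepS hHo E hF hS).ρ (QuotientGroup.mk u) z).1 =
      (classBarSRep K S).ρ (u : GaloisGroupUnramifiedOutside K ↑S) z.1 := rfl

/-- **`ofLayerS hE x` is `V̄_E`-invariant** (`Gal(K_S/E)` fixes the image of `C_E`; -w3's `classBarSRep_ρ_mk_ofLayerS_of_mem`),
in the unfolded form of membership in the layer object. [cite: NeukirchSchmidtWingberg2008, VIII §3 (8.3.7)] -/
theorem resSD_ρ_ofLayerS_of_mem
    (v : ↥((OpenSubgroupLayer.layerSubgroup (↑S : Set (HeightOneSpectrum (𝓞 K))) hHo E hF hS :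
        OpenNormalSubgroup ↥(galoisGroupAbove (↑S : Set (HeightOneSpectrum (𝓞 K))) H)) :
      Subgroup ↥(galoisGroupAbove (↑S : Set (HeightOneSpectrum (𝓞 K))) H))) (x : layerClass K E) :
    (resSD K S H).obj.ρ (v : ↥(galoisGroupAbove (↑S : Set (HeightOneSpectrum (𝓞 K))) H)) (ofLayerS S hS x) =
      ofLayerS S hS x := by
  obtain ⟨σ, hσ⟩ := OpenSubgroupLayer.toAbove_surjective (↑S : Set (HeightOneSpectrum (𝓞 K))) H v.1
  have hv := v.2
  rw [← hσ] at hv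
  have hσE : (σ : absoluteGaloisGroup K) ∈ galFixing K E.1 :=
    (OpenSubgroupLayer.toAbove_mem_layerSubgroup_iff (↑S : Set (HeightOneSpectrum (𝓞 K))) hHo E hF hS σ).1 hv
  rw [resSD_ρ_apply, ← hσ]
  exact classBarSRep_ρ_mk_ofLayerS_of_mem S hS hσE x

include hHo hF in
/-- `Gal(K̄/E) ≤ H` when `K̄^H ≤ E` (`H` open, hence closed: an automorphism fixing `E ⊇ K̄^H` pointwise lies in `H`).
[cite: NeukirchANT1999, Ch. IV (1.2)] -/
theorem galFixing_le_of_baseField_le : galFixing K E.1 ≤ H := fun _ hσ =>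
  OpenSubgroupLayer.mem_of_forall_smul_eq_self H (Subgroup.isClosed_of_isOpen H hHo) fun x hx =>
    (mem_galFixing_iff K).1 hσ x (hF hx)

/-- An element of the layer object is fixed by `[σ] ∈ G_S` for every `σ ∈ Gal(K̄/E)` (such `σ` lie in `H`, and `σ N_S ∈ V̄_E`).
[cite: NeukirchSchmidtWingberg2008, VIII §3 (8.3.7)] -/
theorem classBarSRep_ρ_mk_coe_layer (z : (layerRepS hHo E hF hS).V) {σ : absoluteGaloisGroup K}
    (hσ : σ ∈ galFixing K E.1) :
    (classBarSRep K S).ρ (QuotientGroup.mk σ) z.1 = z.1 := by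
  have hσH : σ ∈ H := galFixing_le_of_baseField_le hHo E hF hσ
  have hv : OpenSubgroupLayer.toAbove (↑S : Set (HeightOneSpectrum (𝓞 K))) H ⟨σ, hσH⟩ ∈
      OpenSubgroupLayer.layerSubgroup (↑S : Set (HeightOneSpectrum (𝓞 K))) hHo E hF hS :=
    (OpenSubgroupLayer.toAbove_mem_layerSubgroup_iff (↑S : Set (HeightOneSpectrum (𝓞 K))) hHo E hF hS ⟨σ, hσH⟩).2 hσ
  exact z.2 ⟨_, hv⟩

/-! ## §2. The layer group `↥U ⧸ V̄_E ≃* H_E ≤ Gal(E/K)` -/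

omit [NumberField K] in
include hS in
/-- `σ ↦ σ|_E : H → H_E` kills `H ∩ N_S` (`N_S ≤ Gal(K̄/E)`), so it factors through `H ↠ U = H/N_S`.
[cite: NeukirchSchmidtWingberg2008, VIII §3] -/
theorem ker_toAbove_le_ker_toSubgroupImage :
    (OpenSubgroupLayer.toAbove (↑S : Set (HeightOneSpectrum (𝓞 K))) H).ker ≤ (GalLayer.toSubgroupImage H E).ker := by
  intro σ hσ
  rw [MonoidHom.mem_ker] at hσ ⊢
  have hσN : (σ : absoluteGaloisGroup K) ∈ ramificationSubgroup K (↑S : Set (HeightOneSpectrum (𝓞 K))) :=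
    (OpenSubgroupLayer.mem_ker_toAbove_iff (↑S : Set (HeightOneSpectrum (𝓞 K))) H σ).1 hσ
  have hσE : (σ : absoluteGaloisGroup K) ∈ (E.openNormalSubgroup : Subgroup (absoluteGaloisGroup K)) := by
    rw [← galFixing_eq_coe_openNormalSubgroup]
    exact hS hσN
  apply Subtype.ext
  rw [GalLayer.coe_toSubgroupImage_apply, OneMemClass.coe_one]
  exact E.restrictHom_eq_one_of_mem hσE

include hS in
/-- **`[σ N_S] ↦ σ|_E : U → H_E`** (`MonoidHom.liftOfSurjective` of door-c6's `toSubgroupImage` through `toAbove`).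
[cite: SerreGaloisCohomology1997, I §2.2 Prop. 8] [cite: NeukirchSchmidtWingberg2008, VIII §3] -/
def layerGroupHom : ↥(galoisGroupAbove (↑S : Set (HeightOneSpectrum (𝓞 K))) H) →* ↥(GalLayer.subgroupImage H E) :=
  (OpenSubgroupLayer.toAbove (↑S : Set (HeightOneSpectrum (𝓞 K))) H).liftOfSurjective
    (OpenSubgroupLayer.toAbove_surjective (↑S : Set (HeightOneSpectrum (𝓞 K))) H)
    ⟨GalLayer.toSubgroupImage H E, ker_toAbove_le_ker_toSubgroupImage E hS⟩

omit [NumberField K] in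
/-- `layerGroupHom (σ N_S) = σ|_E`. [cite: SerreGaloisCohomology1997, I §2.2 Prop. 8] -/
theorem layerGroupHom_toAbove (σ : H) :
    layerGroupHom E hS (OpenSubgroupLayer.toAbove (↑S : Set (HeightOneSpectrum (𝓞 K))) H σ) =
      GalLayer.toSubgroupImage H E σ :=
  (OpenSubgroupLayer.toAbove (↑S : Set (HeightOneSpectrum (𝓞 K))) H).liftOfRightInverse_comp_apply _ _ _ σ

omit [NumberField K] in
/-- `U → H_E` is onto. [cite: SerreGaloisCohomology1997, I §2.2 Prop. 8] -/
theorem layerGroupHom_surjective : Function.Surjective (layerGroupHom (H := H) E hS) := fun τ => by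
  obtain ⟨σ, rfl⟩ := GalLayer.toSubgroupImage_surjective H E τ
  exact ⟨OpenSubgroupLayer.toAbove _ H σ, layerGroupHom_toAbove E hS σ⟩

/-- **The kernel of `U → H_E` is the layer subgroup `V̄_E = Gal(K_S/E)`.** [cite: SerreGaloisCohomology1997, I §2.2 Prop. 8] -/
theorem layerSubgroup_eq_ker_layerGroupHom :
    ((OpenSubgroupLayer.layerSubgroup (↑S : Set (HeightOneSpectrum (𝓞 K))) hHo E hF hS :
        OpenNormalSubgroup ↥(galoisGroupAbove (↑S : Set (HeightOneSpectrum (𝓞 K))) H)) :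
      Subgroup ↥(galoisGroupAbove (↑S : Set (HeightOneSpectrum (𝓞 K))) H)) = (layerGroupHom (H := H) E hS).ker := by
  ext u
  obtain ⟨σ, rfl⟩ := OpenSubgroupLayer.toAbove_surjective (↑S : Set (HeightOneSpectrum (𝓞 K))) H u
  change OpenSubgroupLayer.toAbove (↑S : Set (HeightOneSpectrum (𝓞 K))) H σ ∈
      OpenSubgroupLayer.layerSubgroup (↑S : Set (HeightOneSpectrum (𝓞 K))) hHo E hF hS ↔ _
  rw [OpenSubgroupLayer.toAbove_mem_layerSubgroup_iff, MonoidHom.mem_ker, layerGroupHom_toAbove, ← Subtype.coe_inj,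
    GalLayer.coe_toSubgroupImage_apply, OneMemClass.coe_one, galFixing_eq_coe_openNormalSubgroup]
  exact (GalLayer.restrictHom_eq_one_iff E (σ : absoluteGaloisGroup K)).symm

/-- **`↥U ⧸ V̄_E ≃* H_E`** (`U/Gal(K_S/E) ≅ Gal(E/K̄^H) ≅` the image of `H` in `Gal(E/K)`; `QuotientGroup.liftEquiv`).
[cite: SerreGaloisCohomology1997, I §2.2 Prop. 8] [cite: NeukirchSchmidtWingberg2008, VIII §3] -/
def layerGroupEquiv :
    ↥(galoisGroupAbove (↑S : Set (HeightOneSpectrum (𝓞 K))) H) ⧸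
        ((OpenSubgroupLayer.layerSubgroup (↑S : Set (HeightOneSpectrum (𝓞 K))) hHo E hF hS :
            OpenNormalSubgroup ↥(galoisGroupAbove (↑S : Set (HeightOneSpectrum (𝓞 K))) H)) :
          Subgroup ↥(galoisGroupAbove (↑S : Set (HeightOneSpectrum (𝓞 K))) H)) ≃*
      ↥(GalLayer.subgroupImage H E) :=
  QuotientGroup.liftEquiv _ (layerGroupHom_surjective E hS) (layerSubgroup_eq_ker_layerGroupHom hHo E hF hS)

/-- `layerGroupEquiv [u] = layerGroupHom u`. [cite: SerreGaloisCohomology1997, I §2.2 Prop. 8] -/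
theorem layerGroupEquiv_mk (u : ↥(galoisGroupAbove (↑S : Set (HeightOneSpectrum (𝓞 K))) H)) :
    layerGroupEquiv hHo E hF hS (QuotientGroup.mk u) = layerGroupHom E hS u := rfl

/-- **Values: `(layerGroupEquiv [σ N_S] : Gal(E/K)) = σ|_E`.** [cite: SerreGaloisCohomology1997, I §2.2 Prop. 8] -/
theorem coe_layerGroupEquiv_mk_toAbove (σ : H) :
    ((layerGroupEquiv hHo E hF hS
        (QuotientGroup.mk (OpenSubgroupLayer.toAbove (↑S : Set (HeightOneSpectrum (𝓞 K))) H σ)) :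
        GalLayer.subgroupImage H E) : E.1 ≃ₐ[K] E.1) = E.restrictHom (σ : absoluteGaloisGroup K) := by
  rw [layerGroupEquiv_mk, layerGroupHom_toAbove, GalLayer.coe_toSubgroupImage_apply]

/-- `layerGroupEquiv⁻¹ (σ|_E) = [σ N_S]`. [cite: SerreGaloisCohomology1997, I §2.2 Prop. 8] -/
theorem layerGroupEquiv_symm_toSubgroupImage (σ : H) :
    (layerGroupEquiv hHo E hF hS).symm (GalLayer.toSubgroupImage H E σ) =
      QuotientGroup.mk (OpenSubgroupLayer.toAbove (↑S : Set (HeightOneSpectrum (𝓞 K))) H σ) :=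
  (MulEquiv.symm_apply_eq _).2 ((layerGroupEquiv_mk hHo E hF hS _).trans (layerGroupHom_toAbove E hS σ)).symm

/-! ## §3. The layer module map `C_S(E) → (Res_U C̄_S)^{V̄_E}` -/

/-- `ofLayerS hE` into the `V̄_E`-invariants of `Res_U C̄_S`, additively. [cite: Harari2020, §17.1 Thm. 17.2 (proof)] -/
def ofLayerSInv : layerClass K E →+ (layerRepS hHo E hF hS).V where
  toFun x := ⟨ofLayerS S hS x, fun v => resSD_ρ_ofLayerS_of_mem hHo E hF hS v x⟩
  map_zero' := Subtype.ext (map_zero (ofLayerS S hS))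
  map_add' x y := Subtype.ext (map_add (ofLayerS S hS) x y)

/-- Values of `ofLayerSInv`. [cite: Harari2020, §17.1 Thm. 17.2 (proof)] -/
@[simp] theorem coe_ofLayerSInv (x : layerClass K E) : (ofLayerSInv hHo E hF hS x).1 = ofLayerS S hS x := rfl

/-- `ofLayerSInv` as a `ℤ`-linear map for the `Module ℤ` structures carried by the `Rep` objects.
[cite: Harari2020, §17.1 Thm. 17.2 (proof)] -/
def ofLayerSInvₗ : letI := (layerRepS hHo E hF hS).hV2; layerClass K E →ₗ[ℤ] (layerRepS hHo E hF hS).V :=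
  letI := (layerRepS hHo E hF hS).hV2
  { ofLayerSInv hHo E hF hS with
    map_smul' := fun c x => map_intCast_smul (ofLayerSInv hHo E hF hS) ℤ ℤ c x }

/-- Values of `ofLayerSInvₗ`. [cite: Harari2020, §17.1 Thm. 17.2 (proof)] -/
theorem ofLayerSInvₗ_apply (x : layerClass K E) : ofLayerSInvₗ hHo E hF hS x = ofLayerSInv hHo E hF hS x := rfl

/-- `ofLayerSInvₗ` kills `U_{E,S}`. [cite: Harari2020, Def. 15.38] -/
theorem ofLayerSInvₗ_unitsOffToClass (u : haveI := E.numberField; (IdeleCohomology.unitsOffRep K E.1 S).V) :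
    ofLayerSInvₗ hHo E hF hS (haveI := E.numberField; (IdeleCohomology.unitsOffToClass (F := K) (E := E.1) S).hom u) = 0 :=
  Subtype.ext (ofLayerS_unitsOffToClass S hS u)

/-- **`toLayerS : C_S(E) → (Res_U C̄_S)^{V̄_E}`**, the descent of `C_E → C̄_S^{Gal(K_S/E)}` through `C_E ↠ C_S(E) = C_E ⧸ U_{E,S}`
(`RepCokernel.desc`), as an additive map. [cite: Harari2020, §17.1 Thm. 17.2 (proof)] [cite: NeukirchSchmidtWingberg2008, VIII §3 (8.3.8)] -/
def toLayerS : (haveI := E.numberField; (IdeleCohomology.classModUnitsRep K E.1 S).V) →+ (layerRepS hHo E hF hS).V :=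
  haveI := E.numberField
  letI := (layerRepS hHo E hF hS).hV2
  (RepCokernel.desc (IdeleCohomology.unitsOffToClass (F := K) (E := E.1) S) (ofLayerSInvₗ hHo E hF hS)
    (ofLayerSInvₗ_unitsOffToClass hHo E hF hS)).toAddMonoidHom

/-- **`toLayerS [x] = ofLayerS hE x`** on classes `[x] = π x ∈ C_S(E)`. [cite: Harari2020, §17.1 Thm. 17.2 (proof)] -/
theorem toLayerS_π (x : layerClass K E) :
    toLayerS hHo E hF hS (haveI := E.numberField;
        (cokernel.π (IdeleCohomology.unitsOffToClass (F := K) (E := E.1) S)).hom x) = ofLayerSInv hHo E hF hS x :=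
  haveI := E.numberField
  letI := (layerRepS hHo E hF hS).hV2
  RepCokernel.desc_π (IdeleCohomology.unitsOffToClass (F := K) (E := E.1) S) (ofLayerSInvₗ hHo E hF hS)
    (ofLayerSInvₗ_unitsOffToClass hHo E hF hS) x

/-- Values: `(toLayerS [x] : C̄_S) = ofLayerS hE x`. [cite: Harari2020, §17.1 Thm. 17.2 (proof)] -/
theorem coe_toLayerS_π (x : layerClass K E) :
    (toLayerS hHo E hF hS (haveI := E.numberField;
        (cokernel.π (IdeleCohomology.unitsOffToClass (F := K) (E := E.1) S)).hom x)).1 = ofLayerS S hS x := by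
  rw [toLayerS_π, coe_ofLayerSInv]

/-! ### The kernel and image hypotheses

The kernel statement `ker(C_E → C̄_S) ⊆ U_{E,S}` (`U_{M,S}·Mˣ ∩ C_E = U_{E,S}·Eˣ` for the layers `M ⊇ E` inside `K_S`; -w3 g17's
`ofLayerS_eq_zero_iff`, file `IdeleClassBarSLayerKernel`) and the image statement `C̄_S^{Gal(K_S/E)} ⊆ im(C_E → C̄_S)` (NSW (8.3.7)
`C_S(K_S)^{G_S(L)} = C_S(L)`, via `H¹(Gal(M/E), U_{M,S}) = 0`; its announced sequel) enter below as the section HYPOTHESES `hker`,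
`himg` (stated inline, so that this file neither waits on those files nor files a named fact; the assembly discharges them
by name). [cite: NeukirchSchmidtWingberg2008, VIII §3 (8.3.7)–(8.3.9)] [cite: Harari2020, Def. 15.38, §17.1 Thm. 17.2] -/

variable
  (hker : haveI := E.numberField
    ∀ x : layerClass K E, ofLayerS S hS x = 0 → x ∈ (IdeleCohomology.unitsOffToClass (F := K) (E := E.1) S).hom.range)
  (himg : ∀ z : (classBarSRep K S).V,
    (∀ σ : absoluteGaloisGroup K, σ ∈ galFixing K E.1 → (classBarSRep K S).ρ (QuotientGroup.mk σ) z = z) →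
      ∃ x : layerClass K E, ofLayerS S hS x = z)

include hker in
/-- **`toLayerS` is injective** under the kernel hypothesis (the kernel of `C_E → C̄_S` is exactly `U_{E,S}`).
[cite: Harari2020, Def. 15.38, §17.1 Thm. 17.2] [cite: NeukirchSchmidtWingberg2008, VIII §3 (8.3.8)–(8.3.9)] -/
theorem toLayerS_injective : Function.Injective (toLayerS hHo E hF hS) :=
  haveI := E.numberField
  letI := (layerRepS hHo E hF hS).hV2
  RepCokernel.desc_injective (IdeleCohomology.unitsOffToClass (F := K) (E := E.1) S) (ofLayerSInvₗ hHo E hF hS)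
    (ofLayerSInvₗ_unitsOffToClass hHo E hF hS) fun x hx => hker x (congrArg Subtype.val hx)

include himg in
/-- **`toLayerS` is surjective** under the image hypothesis. [cite: NeukirchSchmidtWingberg2008, VIII §3 (8.3.7)] -/
theorem toLayerS_surjective_of_image : Function.Surjective (toLayerS hHo E hF hS) := by
  haveI := E.numberField
  letI := (layerRepS hHo E hF hS).hV2
  refine RepCokernel.desc_surjective (IdeleCohomology.unitsOffToClass (F := K) (E := E.1) S) (ofLayerSInvₗ hHo E hF hS)
    (ofLayerSInvₗ_unitsOffToClass hHo E hF hS) fun z => ?_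
  obtain ⟨x, hx⟩ := himg z.1 fun σ hσ => classBarSRep_ρ_mk_coe_layer hHo E hF hS z hσ
  exact ⟨x, Subtype.ext hx⟩

/-- **Equivariance of `toLayerS`**: `toLayerS (σ|_E • y) = [σ N_S] • toLayerS y` for `σ ∈ H` and `y ∈ C_S(E)` (on `C_E` both
sides are `ofLayerS (σ|_E • x)`, -w3's `classBarSRep_ρ_mk_ofLayerS`). [cite: Harari2020, §17.1 Thm. 17.2 (proof)] -/
theorem toLayerS_ρ (σ : H) (y : haveI := E.numberField; (IdeleCohomology.classModUnitsRep K E.1 S).V) :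
    toLayerS hHo E hF hS (haveI := E.numberField;
        (IdeleCohomology.classModUnitsRep K E.1 S).ρ (E.restrictHom (σ : absoluteGaloisGroup K)) y) =
      (layerRepS hHo E hF hS).ρ (QuotientGroup.mk (OpenSubgroupLayer.toAbove (↑S : Set (HeightOneSpectrum (𝓞 K))) H σ))
        (toLayerS hHo E hF hS y) := by
  haveI := E.numberField
  obtain ⟨x, rfl⟩ := RepCokernel.hom_π_surjective (IdeleCohomology.unitsOffToClass (F := K) (E := E.1) S) y
  have h1 : (IdeleCohomology.classModUnitsRep K E.1 S).ρ (E.restrictHom (σ : absoluteGaloisGroup K))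
      ((cokernel.π (IdeleCohomology.unitsOffToClass (F := K) (E := E.1) S)).hom x) =
      (cokernel.π (IdeleCohomology.unitsOffToClass (F := K) (E := E.1) S)).hom
        ((IdeleClassGroup.galoisRep K E.1).ρ (E.restrictHom (σ : absoluteGaloisGroup K)) x) :=
    (Rep.hom_comm_apply (cokernel.π (IdeleCohomology.unitsOffToClass (F := K) (E := E.1) S)) _ x).symm
  have h2 : (classBarSRep K S).ρ (QuotientGroup.mk (σ : absoluteGaloisGroup K)) (ofLayerS S hS x) =
      ofLayerS S hS ((IdeleClassGroup.galoisRep K E.1).ρ (E.restrictHom (σ : absoluteGaloisGroup K)) x) :=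
    classBarSRep_ρ_mk_ofLayerS S (σ : absoluteGaloisGroup K) hS x
  -- `simp only`, not `rw`: the rewrite patterns are `DFunLike.coe` applications (reducible-transparency matching)
  simp only [h1, toLayerS_π]
  apply Subtype.ext
  simp only [coe_ofLayerSInv, coe_layerRepS_ρ_mk, OpenSubgroupLayer.coe_toAbove]
  exact h2.symm

/-! ## §4. The layer module and cohomology isomorphisms (under the image hypothesis) -/

/-- Pointwise criterion for `e ∘ f = g ∘ e` with the module structures taken from the maps (implicit, not
instance-implicit, binders: the carriers of `Rep` objects carry their own `Module ℤ` structures). [folklore] -/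
private theorem linearEquiv_comp_eq_comp_of_apply {R M N : Type*} {_ : Semiring R} {_ : AddCommMonoid M} {_ : AddCommMonoid N}
    {_ : Module R M} {_ : Module R N} (e : M ≃ₗ[R] N) (f : M →ₗ[R] M) (g : N →ₗ[R] N)
    (h : ∀ x, e (f x) = g (e x)) : e.toLinearMap ∘ₗ f = g ∘ₗ e.toLinearMap :=
  LinearMap.ext h


include hker himg in
/-- **`(Res_U C̄_S)^{V̄_E} ≃ₗ[ℤ] C_S(E)`** under the kernel and image hypotheses (the inverse of the bijection `toLayerS`; `ℤ`-linear for the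
`Module ℤ` structures carried by the `Rep` objects). [cite: NeukirchSchmidtWingberg2008, VIII §3 (8.3.7)–(8.3.8)] [cite: Harari2020, §17.1 Thm. 17.2] -/
def layerModuleEquivS :
    haveI := E.numberField
    letI := (layerRepS hHo E hF hS).hV2
    letI := (IdeleCohomology.classModUnitsRep K E.1 S).hV2
    (layerRepS hHo E hF hS).V ≃ₗ[ℤ] (IdeleCohomology.classModUnitsRep K E.1 S).V :=
  haveI := E.numberField
  letI := (layerRepS hHo E hF hS).hV2
  letI := (IdeleCohomology.classModUnitsRep K E.1 S).hV2
  { (AddEquiv.ofBijective (toLayerS hHo E hF hS)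
        ⟨toLayerS_injective hHo E hF hS hker, toLayerS_surjective_of_image hHo E hF hS himg⟩).symm with
    map_smul' := fun c z =>
      map_intCast_smul (AddEquiv.ofBijective (toLayerS hHo E hF hS)
        ⟨toLayerS_injective hHo E hF hS hker, toLayerS_surjective_of_image hHo E hF hS himg⟩).symm ℤ ℤ c z }

/-- `layerModuleEquivS (toLayerS y) = y`. [cite: Harari2020, §17.1 Thm. 17.2] -/
theorem layerModuleEquivS_toLayerS
    (y : haveI := E.numberField; (IdeleCohomology.classModUnitsRep K E.1 S).V) :
    haveI := E.numberField
    letI := (layerRepS hHo E hF hS).hV2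
    letI := (IdeleCohomology.classModUnitsRep K E.1 S).hV2
    layerModuleEquivS hHo E hF hS hker himg (toLayerS hHo E hF hS y) = y :=
  (AddEquiv.ofBijective (toLayerS hHo E hF hS)
    ⟨toLayerS_injective hHo E hF hS hker, toLayerS_surjective_of_image hHo E hF hS himg⟩).symm_apply_apply y

set_option maxHeartbeats 1600000 in
-- unifying the `ℤ`-module structures carried by the layer objects (`Submodule.module` on the invariants of a quotient
-- module, vs `Rep.hV2` of the restricted `C_S(E)`) at the `refine` is slow; the proof itself is three rewrites
/-- **Equivariance of the layer isomorphism along `layerGroupEquiv`** (the hypothesis `he` of Mathlib's `groupCohomology.mapIso`):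
for `g ∈ ↥U ⧸ V̄_E`, `layerModuleEquivS ∘ (g • ·) = ((layerGroupEquiv g : Gal(E/K)) • ·) ∘ layerModuleEquivS`.
[cite: SerreGaloisCohomology1997, I §2.2 Prop. 8] [cite: Harari2020, §17.1 Thm. 17.2] -/
theorem layerModuleEquivS_comm
    (g : ↥(galoisGroupAbove (↑S : Set (HeightOneSpectrum (𝓞 K))) H) ⧸
      ((OpenSubgroupLayer.layerSubgroup (↑S : Set (HeightOneSpectrum (𝓞 K))) hHo E hF hS :
          OpenNormalSubgroup ↥(galoisGroupAbove (↑S : Set (HeightOneSpectrum (𝓞 K))) H)) :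
        Subgroup ↥(galoisGroupAbove (↑S : Set (HeightOneSpectrum (𝓞 K))) H))) :
    haveI := E.numberField
    letI := (layerRepS hHo E hF hS).hV2
    letI := (IdeleCohomology.classModUnitsRep K E.1 S).hV2
    (layerModuleEquivS hHo E hF hS hker himg).toLinearMap ∘ₗ (layerRepS hHo E hF hS).ρ g =
      (Rep.res (GalLayer.subgroupImage H E).subtype (IdeleCohomology.classModUnitsRep K E.1 S)).ρ
          (layerGroupEquiv hHo E hF hS g) ∘ₗ
        (layerModuleEquivS hHo E hF hS hker himg).toLinearMap := by
  haveI := E.numberField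
  letI := (layerRepS hHo E hF hS).hV2
  letI := (IdeleCohomology.classModUnitsRep K E.1 S).hV2
  induction g using QuotientGroup.induction_on with
  | H u =>
    obtain ⟨σ, rfl⟩ := OpenSubgroupLayer.toAbove_surjective (↑S : Set (HeightOneSpectrum (𝓞 K))) H u
    refine linearEquiv_comp_eq_comp_of_apply _ _ _ fun z => ?_
    obtain ⟨y, rfl⟩ := toLayerS_surjective_of_image hHo E hF hS himg z
    have h3 := layerModuleEquivS_toLayerS hHo E hF hS hker himg y
    have h4 := layerModuleEquivS_toLayerS hHo E hF hS hker himg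
      ((IdeleCohomology.classModUnitsRep K E.1 S).ρ (E.restrictHom (σ : absoluteGaloisGroup K)) y)
    simp only [toLayerS_ρ] at h4
    rw [h4, h3, MonoidHom.comp_apply, Subgroup.subtype_apply, coe_layerGroupEquiv_mk_toAbove]

/-- **`Hⁿ(↥U ⧸ V̄_E, (Res_U C̄_S)^{V̄_E}) ≅ Hⁿ(H_E, Res_{H_E} C_S(E))`** (Mathlib `groupCohomology.mapIso` along `layerGroupEquiv` and
`layerModuleEquivS`): the finite layers of `Hⁿ(U, C̄_S)` ARE the groups `Hⁿ(H_E, C_S(E))`.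
[cite: SerreGaloisCohomology1997, I §2.2 Prop. 8] [cite: Harari2020, §17.1 Thm. 17.2] -/
def layerCohomologyIsoS (n : ℕ) :
    haveI := E.numberField
    groupCohomology (layerRepS hHo E hF hS) n ≅
      groupCohomology (Rep.res (GalLayer.subgroupImage H E).subtype (IdeleCohomology.classModUnitsRep K E.1 S)) n :=
  haveI := E.numberField
  groupCohomology.mapIso (layerGroupEquiv hHo E hF hS) (layerModuleEquivS hHo E hF hS hker himg)
    (layerModuleEquivS_comm hHo E hF hS hker himg) n

end SLayers

end IdeleClassBar

end Literature.NumberTheory.GaloisRepresentations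

end
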